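import Mathlib
import Literature.Analysis.Convex.SchauderFixedPoint
import HarnessLib

/-!
# Granas' topological transversality theorem and the Leray–Schauder continuation principle
# (compact maps on closed convex sets of a real normed space)

Analysis/Convex file (everything PROVED from the tree's Schauder fixed point theorem
`Literature.Analysis.Convex.exists_fixedPoint_of_isCompact_closure`; no definitions, no named facts,
no degree theory).

Source: R. Precup, *Theorems of Leray–Schauder Type and Applications*, Taylor & Francis 2002,
Chapter 5 «Continuation theorems involving compactness», §5.1–§5.2 (PDF pp. 65–69), the COMPACT
class `M_C`: Proposition 5.5 (constant maps are essential), Theorem 5.4 (Granas' topological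
transversality theorem [Granas 1976]), Theorem 5.3 (the Leray–Schauder / Mönch continuation
principle, compact case, Remark 5.1).  The book works in a Banach space; completeness is not used
once the maps are assumed compact (relatively compact range), exactly as in the tree's Schauder file.

SETTING.  `X` a real normed space, `K ⊆ X` closed convex (the book's `K`), `C ⊆ K` closed (the
book's `Ū`, closure of a set `U` open in `K`) and `B ⊆ C` closed (the book's `∂U`, boundary relative
to `K`).  The only topological relation between them that the proofs use is
`C ∩ closure (K \ C) ⊆ B` («a point of `Ū` adherent to `K \ Ū` is a boundary point»), which is how
the relative boundary enters the pasting step of Proposition 5.5; Theorems 5.4 needs no relation at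
all.  A COMPACT MAP `T : Ū → K` is `ContinuousOn T C ∧ MapsTo T C K ∧ IsCompact (closure (T '' C))`;
`T` is ESSENTIAL (in `M_C`) when it is fixed-point free on `B` and every compact map agreeing with
`T` on `B` has a fixed point in `C` — these notions are spelled out in the hypotheses (no new
definitions).

* `continuousOn_piecewise_const` — pasting: `T` on `C`, the constant `x₀` on `K \ C`, is continuous
  on `K` when `T = x₀` on `B ⊇ C ∩ closure (K \ C)`.
* `exists_fixedPoint_of_eqOn_const` — **Prop. 5.5** (compact case): a compact map `T : C → K` that is
  CONSTANT `= x₀ ∈ C` on `B` has a fixed point in `C` (extend by `x₀` to `K`, Schauder).  I.e. the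
  constant map `x₀` (`x₀ ∈ U`) is essential.
* `disjoint_closure_fixedSet` — the set `Σ = {x ∈ C | ∃ t ∈ [0,1], H(x,t) = x}` of a compact homotopy
  fixed-point free on the closed set `B` has closure disjoint from `B`.
* `exists_fixedPoint_of_homotopy_of_essential` — **Thm. 5.4** (topological transversality, fixed
  point form): a compact homotopy `H : C × [0,1] → K`, fixed-point free on `B`, with `H(·,0)`
  essential, has `Fix H(·,1) ≠ ∅`.  Proof as printed: Urysohn function `v` (`= 0` on `B`, `= 1` on
  `Σ̄`), the compact map `x ↦ H(x, v x)` agrees with `H(·,0)` on `B`, so it has a fixed point `y`;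
  then `y ∈ Σ`, `v y = 1`, `H(y,1) = y`.
* `essential_of_homotopy` — **Thm. 5.4** (full form): moreover `H(·,1)` is essential (concatenate
  `H` with the segment from `H(·,1)` to any compact `T₁` agreeing with it on `B`; `K` convex).
* `exists_fixedPoint_of_homotopy_const` — continuation from a constant: a compact homotopy in `K`,
  fixed-point free on `B`, starting at a constant map `x₀ ∈ C`, ends at a map with a fixed point.
* `exists_fixedPoint_leraySchauder` — **Thm. 5.3** (compact case; the LERAY–SCHAUDER PRINCIPLE):
  `T : C → K` compact, `x₀ ∈ C`, and `(1−t)x₀ + tT x ≠ x` for `x ∈ B`, `t ∈ [0,1]` ⟹ `T` has a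
  fixed point in `C`.
* `essential_of_leraySchauder_boundary`, `essential_of_contractive` (appended) — the Leray–Schauder
  boundary condition (in particular an attracting centre `p ∈ C \ B`, `‖T x − p‖ ≤ q‖x − p‖`, `q < 1`)
  makes a compact map ESSENTIAL, i.e. a valid start for further continuations.
* `essential_of_homotopy_interval`, `leraySchauder_alternative_ball` (appended) — transversality
  along a parameter interval `[a, b]`, and the nonlinear alternative on `K ∩ B̄(x₀, r)` (either a
  fixed point, or an eigen-solution `x = (1−t)x₀ + tT x`, `t ∈ (0,1)`, on the sphere).
* `exists_fixedPoint_of_homotopy_const_of_isCompact`, `exists_fixedPoint_of_homotopy_contractive`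
  (appended) — packaged continuations over `[a, b]`: compact domain + constant start (Brouwer-type
  continuation in `ℝⁿ`; on a compact domain the range is automatically relatively compact), and
  compact homotopy + contractive start.
* `exists_fixedPoint_leraySchauder_isOpen` (appended) — the classical form: `U` open in `X`, `x₀ ∈ U`,
  boundary condition on `frontier U`.

## Mathlib / tree search

Mathlib v4.32.0 has no Leray–Schauder degree, continuation principle or essential maps
(`lean search 'Leray.?Schauder|essential map|topological transversality'`: docstring mentions
only).  Used: the tree's Schauder theorem; Mathlib's Urysohn lemma
`exists_continuous_zero_one_of_isClosed` (normed spaces are normal), `IsCompact.tendsto_subseq`,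
`IsCompact.closure_of_subset`, `ContinuousWithinAt.union`, `continuousWithinAt_of_notMem_closure`.

## References

* R. Precup, *Theorems of Leray–Schauder Type and Applications*, Taylor & Francis (2002), Ch. 5,
  Prop. 5.1, Thm. 5.3, Thm. 5.4, Prop. 5.5 (PDF pp. 65–69). [Precup2002]
* A. Granas, *Sur la méthode de continuité de Poincaré*, C. R. Acad. Sci. Paris 282 (1976) 983–985.
* A. Granas, J. Dugundji, *Fixed Point Theory*, Springer (2003), §I.6.
-/

noncomputable section

open Metric Set Filter
open scoped Topology

namespace Literature.Analysis.Convex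

section TopologicalTransversality

variable {X : Type*} [NormedAddCommGroup X] [NormedSpace ℝ X]

/-! ### Pasting a compact map with a constant outside its domain -/

omit [NormedSpace ℝ X] in
/-- **Pasting lemma** behind Prop. 5.5: if `C` is closed, `T` is continuous on `C` and equal to the
constant `x₀` on a set `B ⊇ C ∩ closure (K \ C)` (every point of `C` adherent to `K \ C`), then the map
`x ↦ T x` on `C`, `x ↦ x₀` off `C`, is continuous on `K`. [cite: Precup2002, Ch. 5, proof of Prop. 5.5] -/
theorem continuousOn_piecewise_const {K C B : Set X} [DecidablePred (· ∈ C)] {T : X → X} {x₀ : X}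
    (hC : IsClosed C) (hB : C ∩ closure (K \ C) ⊆ B) (hT : ContinuousOn T C)
    (hTB : ∀ x ∈ B, T x = x₀) :
    ContinuousOn (fun x => if x ∈ C then T x else x₀) K := by
  intro a ha
  set F : X → X := fun x => if x ∈ C then T x else x₀ with hFdef
  -- within `K ∩ C`
  have h1 : ContinuousWithinAt F (K ∩ C) a := by
    by_cases haC : a ∈ C
    · refine ((hT a haC).mono inter_subset_right).congr (fun x hx => ?_) ?_
      · simp only [hFdef, if_pos hx.2]
      · simp only [hFdef, if_pos haC]
    · refine continuousWithinAt_of_notMem_closure fun h => haC ?_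
      exact closure_minimal inter_subset_right hC h
  -- within `K \ C`
  have h2 : ContinuousWithinAt F (K \ C) a := by
    by_cases hacl : a ∈ closure (K \ C)
    · have hFa : F a = x₀ := by
        by_cases haC : a ∈ C
        · simp only [hFdef, if_pos haC]; exact hTB a (hB ⟨haC, hacl⟩)
        · simp only [hFdef, if_neg haC]
      refine (continuousWithinAt_const (b := x₀)).congr (fun x hx => ?_) hFa
      simp only [hFdef, if_neg hx.2]
    · exact continuousWithinAt_of_notMem_closure hacl
  exact (h1.union h2).mono fun x hx => by
    by_cases hxC : x ∈ C
    · exact Or.inl ⟨hx, hxC⟩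
    · exact Or.inr ⟨hx, hxC⟩

/-! ### Constant maps are essential (Precup, Prop. 5.5, compact case) -/

/-- **Constant maps are essential** (Precup, Prop. 5.5, class `M_C`).  Let `K` be closed convex,
`C ⊆ K` closed, `B ⊇ C ∩ closure (K \ C)` (the relative boundary), `x₀ ∈ C`.  Every compact map
`T : C → K` (continuous on `C`, `T(C) ⊆ K`, `T(C)` relatively compact) which equals the constant `x₀`
on `B` has a fixed point in `C`.  Proof as printed: extend `T` by `x₀` outside `C` to a compact
self-map of `K` and apply Schauder; a fixed point outside `C` would be `x₀ ∈ C`.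
[cite: Precup2002, Ch. 5, Prop. 5.5] -/
theorem exists_fixedPoint_of_eqOn_const {K C B : Set X} {T : X → X} {x₀ : X}
    (hKconv : Convex ℝ K) (hKcl : IsClosed K) (hCK : C ⊆ K) (hC : IsClosed C)
    (hB : C ∩ closure (K \ C) ⊆ B) (hx₀ : x₀ ∈ C)
    (hT : ContinuousOn T C) (hTK : MapsTo T C K) (hcomp : IsCompact (closure (T '' C)))
    (hTB : ∀ x ∈ B, T x = x₀) : ∃ x ∈ C, T x = x := by
  classical
  set F : X → X := fun x => if x ∈ C then T x else x₀ with hFdef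
  have hFcont : ContinuousOn F K := continuousOn_piecewise_const hC hB hT hTB
  have hFmaps : MapsTo F K K := by
    intro x hx
    by_cases h : x ∈ C
    · simp only [hFdef, if_pos h]; exact hTK h
    · simp only [hFdef, if_neg h]; exact hCK hx₀
  have hFcomp : IsCompact (closure (F '' K)) := by
    refine (hcomp.union (isCompact_singleton : IsCompact ({x₀} : Set X))).closure_of_subset ?_
    rintro _ ⟨x, hx, rfl⟩
    by_cases h : x ∈ C
    · left; simp only [hFdef, if_pos h]; exact subset_closure (mem_image_of_mem T h)
    · right; simp only [hFdef, if_neg h]; exact mem_singleton x₀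
  obtain ⟨y, hyK, hy⟩ :=
    exists_fixedPoint_of_isCompact_closure hKconv hKcl ⟨x₀, hCK hx₀⟩ hFcont hFmaps hFcomp
  by_cases hyC : y ∈ C
  · refine ⟨y, hyC, ?_⟩
    simpa only [hFdef, if_pos hyC] using hy
  · exfalso
    have : x₀ = y := by simpa only [hFdef, if_neg hyC] using hy
    exact hyC (this ▸ hx₀)

/-! ### Granas' topological transversality theorem (Precup, Thm. 5.4, compact case) -/

omit [NormedSpace ℝ X] in
/-- The fixed set `Σ = {x ∈ C | ∃ t ∈ [0,1], H(x,t) = x}` of a homotopy `H`, continuous on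
`C × [0,1]` (`B ⊆ C`) and fixed-point free on `B`, has closure disjoint from `B`
(compactness of `[0,1]`).  [cite: Precup2002, Ch. 5, proof of Thm. 5.4 («clearly `Σ` and `∂U` are disjoint»; `Σ` is closed)] -/
theorem disjoint_closure_fixedSet {C B : Set X} {H : X → ℝ → X} (hBC : B ⊆ C)
    (hH : ContinuousOn (fun p : X × ℝ => H p.1 p.2) (C ×ˢ Icc (0 : ℝ) 1))
    (hfpf : ∀ x ∈ B, ∀ t ∈ Icc (0 : ℝ) 1, H x t ≠ x) :
    Disjoint B (closure {x | x ∈ C ∧ ∃ t ∈ Icc (0 : ℝ) 1, H x t = x}) := by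
  rw [Set.disjoint_left]
  intro x hxB hxcl
  obtain ⟨u, hu, hux⟩ := mem_closure_iff_seq_limit.1 hxcl
  choose huC t ht htu using hu
  obtain ⟨l, hl, φ, hφ, hlim⟩ := (isCompact_Icc (a := (0 : ℝ)) (b := 1)).tendsto_subseq ht
  have hxC : x ∈ C := hBC hxB
  -- `H (u (φ n)) (t (φ n)) → H x l` by continuity of `H` on `C × [0,1]`
  have hpair : Tendsto (fun n => (u (φ n), t (φ n))) atTop (𝓝[C ×ˢ Icc (0 : ℝ) 1] (x, l)) := by
    refine tendsto_nhdsWithin_iff.2 ⟨?_, Eventually.of_forall fun n => ⟨huC _, ht _⟩⟩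
    exact (hux.comp hφ.tendsto_atTop).prodMk_nhds hlim
  have h1 : Tendsto (fun n => H (u (φ n)) (t (φ n))) atTop (𝓝 (H x l)) :=
    (hH (x, l) ⟨hxC, hl⟩).tendsto.comp hpair
  -- but `H (u (φ n)) (t (φ n)) = u (φ n) → x`
  have h2 : Tendsto (fun n => H (u (φ n)) (t (φ n))) atTop (𝓝 x) := by
    have : (fun n => H (u (φ n)) (t (φ n))) = fun n => u (φ n) := funext fun n => htu (φ n)
    rw [this]
    exact hux.comp hφ.tendsto_atTop
  exact hfpf x hxB l hl (tendsto_nhds_unique h1 h2)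

omit [NormedSpace ℝ X] in
/-- **Granas' topological transversality theorem, fixed point form** (Precup, Thm. 5.4, class
`M_C`).  Let `B ⊆ C` with `B` closed, and let `H : C × [0,1] → K` be a COMPACT homotopy
(continuous on `C × [0,1]`, values in `K`, relatively compact range) which is fixed-point free on
`B`.  If `H(·,0)` is ESSENTIAL — every compact map `T : C → K` agreeing with `H(·,0)` on `B` has a
fixed point in `C` — then `H(·,1)` has a fixed point in `C`.  Proof as printed: with a Urysohn
function `v : X → [0,1]`, `v = 0` on `B`, `v = 1` on the closure of
`Σ = {x ∈ C | ∃ t, H(x,t) = x}` (disjoint from `B`), the map `x ↦ H(x, v x)` is compact and agrees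
with `H(·,0)` on `B`; a fixed point `y` of it lies in `Σ`, so `v y = 1` and `H(y,1) = y`.
[cite: Precup2002, Ch. 5, Thm. 5.4] -/
theorem exists_fixedPoint_of_homotopy_of_essential {K C B : Set X} {H : X → ℝ → X}
    (hBC : B ⊆ C) (hBcl : IsClosed B)
    (hH : ContinuousOn (fun p : X × ℝ => H p.1 p.2) (C ×ˢ Icc (0 : ℝ) 1))
    (hHK : ∀ x ∈ C, ∀ t ∈ Icc (0 : ℝ) 1, H x t ∈ K)
    (hcomp : IsCompact (closure ((fun p : X × ℝ => H p.1 p.2) '' (C ×ˢ Icc (0 : ℝ) 1))))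
    (hfpf : ∀ x ∈ B, ∀ t ∈ Icc (0 : ℝ) 1, H x t ≠ x)
    (hess : ∀ T : X → X, ContinuousOn T C → MapsTo T C K → IsCompact (closure (T '' C)) →
      (∀ x ∈ B, T x = H x 0) → ∃ x ∈ C, T x = x) :
    ∃ x ∈ C, H x 1 = x := by
  set S : Set X := {x | x ∈ C ∧ ∃ t ∈ Icc (0 : ℝ) 1, H x t = x} with hSdef
  have hdisj : Disjoint B (closure S) := disjoint_closure_fixedSet hBC hH hfpf
  obtain ⟨v, hv0, hv1, hv01⟩ := exists_continuous_zero_one_of_isClosed hBcl isClosed_closure hdisj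
  -- the map `T x = H (x, v x)`
  set T : X → X := fun x => H x (v x) with hTdef
  have hg : ContinuousOn (fun x => (x, v x)) C :=
    (continuousOn_id.prodMk v.continuous.continuousOn)
  have hgmaps : MapsTo (fun x => (x, v x)) C (C ×ˢ Icc (0 : ℝ) 1) := fun x hx => ⟨hx, hv01 x⟩
  have hTcont : ContinuousOn T C := hH.comp hg hgmaps
  have hTK : MapsTo T C K := fun x hx => hHK x hx (v x) (hv01 x)
  have hTcomp : IsCompact (closure (T '' C)) := by
    refine hcomp.closure_of_subset ?_
    rintro _ ⟨x, hx, rfl⟩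
    exact subset_closure ⟨(x, v x), ⟨hx, hv01 x⟩, rfl⟩
  have hTB : ∀ x ∈ B, T x = H x 0 := by
    intro x hx
    simp only [hTdef]
    rw [show v x = 0 from hv0 hx]
  obtain ⟨y, hyC, hy⟩ := hess T hTcont hTK hTcomp hTB
  -- `y ∈ Σ`, so `v y = 1`
  have hyS : y ∈ S := ⟨hyC, v y, hv01 y, hy⟩
  have hvy : v y = 1 := hv1 (subset_closure hyS)
  refine ⟨y, hyC, ?_⟩
  simpa only [hTdef, hvy] using hy

/-- **Granas' topological transversality theorem** (Precup, Thm. 5.4, class `M_C`, full form):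
under the hypotheses of `exists_fixedPoint_of_homotopy_of_essential` with `K` convex, the end map
`H(·,1)` is again ESSENTIAL: every compact map `T₁ : C → K` agreeing with `H(·,1)` on `B` has a fixed
point in `C`.  Proof as printed: apply the fixed point form to the concatenation of `H` with the
segment `(1−s)H(·,1) + sT₁` (which is fixed-point free on `B` because `T₁ = H(·,1)` there), written
without case split as `(x,t) ↦ (1 − s(t))·H(x, r(t)) + s(t)·T₁ x`, `r = min(2t,1)`, `s = max(2t−1,0)`.
[cite: Precup2002, Ch. 5, Thm. 5.4] -/
theorem essential_of_homotopy {K C B : Set X} {H : X → ℝ → X} (hKconv : Convex ℝ K)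
    (hBC : B ⊆ C) (hBcl : IsClosed B)
    (hH : ContinuousOn (fun p : X × ℝ => H p.1 p.2) (C ×ˢ Icc (0 : ℝ) 1))
    (hHK : ∀ x ∈ C, ∀ t ∈ Icc (0 : ℝ) 1, H x t ∈ K)
    (hcomp : IsCompact (closure ((fun p : X × ℝ => H p.1 p.2) '' (C ×ˢ Icc (0 : ℝ) 1))))
    (hfpf : ∀ x ∈ B, ∀ t ∈ Icc (0 : ℝ) 1, H x t ≠ x)
    (hess : ∀ T : X → X, ContinuousOn T C → MapsTo T C K → IsCompact (closure (T '' C)) →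
      (∀ x ∈ B, T x = H x 0) → ∃ x ∈ C, T x = x) :
    ∀ T₁ : X → X, ContinuousOn T₁ C → MapsTo T₁ C K → IsCompact (closure (T₁ '' C)) →
      (∀ x ∈ B, T₁ x = H x 1) → ∃ x ∈ C, T₁ x = x := by
  intro T₁ hT₁ hT₁K hT₁comp hT₁B
  -- reparametrisation `r = min (2t) 1`, `s = max (2t - 1) 0`
  set r : ℝ → ℝ := fun t => min (2 * t) 1 with hrdef
  set s : ℝ → ℝ := fun t => max (2 * t - 1) 0 with hsdef
  have hr_cont : Continuous r := (continuous_const.mul continuous_id).min continuous_const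
  have hs_cont : Continuous s := ((continuous_const.mul continuous_id).sub continuous_const).max
    continuous_const
  have hr_mem : ∀ t ∈ Icc (0 : ℝ) 1, r t ∈ Icc (0 : ℝ) 1 := fun t ht =>
    ⟨le_min (by linarith [ht.1]) zero_le_one, min_le_right _ _⟩
  have hs_mem : ∀ t ∈ Icc (0 : ℝ) 1, s t ∈ Icc (0 : ℝ) 1 := fun t ht =>
    ⟨le_max_right _ _, max_le (by linarith [ht.2]) zero_le_one⟩
  -- the concatenated homotopy
  set G : X → ℝ → X := fun x t => (1 - s t) • H x (r t) + s t • T₁ x with hGdef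
  have hG0 : ∀ x, G x 0 = H x 0 := by
    intro x
    have hr0 : r 0 = 0 := by simp [hrdef]
    have hs0 : s 0 = 0 := by simp [hsdef]
    simp only [hGdef, hr0, hs0, sub_zero, one_smul, zero_smul, add_zero]
  have hG1 : ∀ x, G x 1 = T₁ x := by
    intro x
    have hs1 : s 1 = 1 := by simp only [hsdef]; norm_num
    simp only [hGdef, hs1, sub_self, zero_smul, one_smul, zero_add]
  -- continuity on `C × [0,1]`
  have hGcont : ContinuousOn (fun p : X × ℝ => G p.1 p.2) (C ×ˢ Icc (0 : ℝ) 1) := by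
    have h1 : ContinuousOn (fun p : X × ℝ => H p.1 (r p.2)) (C ×ˢ Icc (0 : ℝ) 1) := by
      have hg : ContinuousOn (fun p : X × ℝ => (p.1, r p.2)) (C ×ˢ Icc (0 : ℝ) 1) :=
        (continuous_fst.prodMk (hr_cont.comp continuous_snd)).continuousOn
      have hgm : MapsTo (fun p : X × ℝ => (p.1, r p.2)) (C ×ˢ Icc (0 : ℝ) 1) (C ×ˢ Icc (0 : ℝ) 1) :=
        fun p hp => ⟨hp.1, hr_mem _ hp.2⟩
      exact hH.comp hg hgm
    have h2 : ContinuousOn (fun p : X × ℝ => T₁ p.1) (C ×ˢ Icc (0 : ℝ) 1) :=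
      hT₁.comp continuous_fst.continuousOn fun p hp => hp.1
    have h3 : ContinuousOn (fun p : X × ℝ => s p.2) (C ×ˢ Icc (0 : ℝ) 1) :=
      (hs_cont.comp continuous_snd).continuousOn
    exact ((continuousOn_const.sub h3).smul h1).add (h3.smul h2)
  -- values in `K` (convexity)
  have hGK : ∀ x ∈ C, ∀ t ∈ Icc (0 : ℝ) 1, G x t ∈ K := by
    intro x hx t ht
    have hst := hs_mem t ht
    exact hKconv (hHK x hx (r t) (hr_mem t ht)) (hT₁K hx) (by linarith [hst.2]) hst.1 (by ring)
  -- relatively compact range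
  have hGcomp : IsCompact (closure ((fun p : X × ℝ => G p.1 p.2) '' (C ×ˢ Icc (0 : ℝ) 1))) := by
    set S₁ := closure ((fun p : X × ℝ => H p.1 p.2) '' (C ×ˢ Icc (0 : ℝ) 1))
    set S₂ := closure (T₁ '' C)
    have hM : IsCompact ((fun w : ℝ × X × X => (1 - w.1) • w.2.1 + w.1 • w.2.2) ''
        (Icc (0 : ℝ) 1 ×ˢ S₁ ×ˢ S₂)) := by
      refine (isCompact_Icc.prod (hcomp.prod hT₁comp)).image ?_
      exact ((continuous_const.sub continuous_fst).smul (continuous_fst.comp continuous_snd)).add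
        (continuous_fst.smul (continuous_snd.comp continuous_snd))
    refine hM.closure_of_subset ?_
    rintro _ ⟨p, hp, rfl⟩
    refine ⟨(s p.2, H p.1 (r p.2), T₁ p.1), ⟨hs_mem _ hp.2, ?_, ?_⟩, rfl⟩
    · exact subset_closure ⟨(p.1, r p.2), ⟨hp.1, hr_mem _ hp.2⟩, rfl⟩
    · exact subset_closure (mem_image_of_mem T₁ hp.1)
  -- fixed-point free on `B`
  have hGfpf : ∀ x ∈ B, ∀ t ∈ Icc (0 : ℝ) 1, G x t ≠ x := by
    intro x hx t ht
    by_cases hle : 2 * t ≤ 1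
    · have hs0 : s t = 0 := by simp only [hsdef]; exact max_eq_right (by linarith)
      have : G x t = H x (r t) := by
        simp only [hGdef, hs0, sub_zero, one_smul, zero_smul, add_zero]
      rw [this]
      exact hfpf x hx (r t) (hr_mem t ht)
    · have hr1 : r t = 1 := by simp only [hrdef]; exact min_eq_right (by linarith)
      have : G x t = H x 1 := by
        simp only [hGdef, hr1, hT₁B x hx]
        rw [← add_smul]; simp
      rw [this]
      exact hfpf x hx 1 ⟨zero_le_one, le_rfl⟩
  have hGess : ∀ T : X → X, ContinuousOn T C → MapsTo T C K → IsCompact (closure (T '' C)) →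
      (∀ x ∈ B, T x = G x 0) → ∃ x ∈ C, T x = x := by
    intro T hT hTK hTc hTB
    exact hess T hT hTK hTc fun x hx => (hTB x hx).trans (hG0 x)
  obtain ⟨y, hyC, hy⟩ :=
    exists_fixedPoint_of_homotopy_of_essential hBC hBcl hGcont hGK hGcomp hGfpf hGess
  exact ⟨y, hyC, by rw [← hG1 y]; exact hy⟩

/-! ### Continuation from a constant map and the Leray–Schauder principle (Precup, Thm. 5.3) -/

/-- **Continuation from a constant map** (Precup, Thm. 5.4 with Prop. 5.5, class `M_C`).  Let `K`
be closed convex, `C ⊆ K` closed, `B ⊆ C` closed with `C ∩ closure (K \ C) ⊆ B`, and let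
`H : C × [0,1] → K` be a compact homotopy, fixed-point free on `B`, with `H(x,0) = x₀ ∈ C` constant.
Then `H(·,1)` has a fixed point in `C`. [cite: Precup2002, Ch. 5, Thm. 5.4 and Prop. 5.5] -/
theorem exists_fixedPoint_of_homotopy_const {K C B : Set X} {H : X → ℝ → X} {x₀ : X}
    (hKconv : Convex ℝ K) (hKcl : IsClosed K) (hCK : C ⊆ K) (hC : IsClosed C) (hBC : B ⊆ C)
    (hBcl : IsClosed B) (hB : C ∩ closure (K \ C) ⊆ B) (hx₀ : x₀ ∈ C)
    (hH : ContinuousOn (fun p : X × ℝ => H p.1 p.2) (C ×ˢ Icc (0 : ℝ) 1))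
    (hHK : ∀ x ∈ C, ∀ t ∈ Icc (0 : ℝ) 1, H x t ∈ K)
    (hcomp : IsCompact (closure ((fun p : X × ℝ => H p.1 p.2) '' (C ×ˢ Icc (0 : ℝ) 1))))
    (hfpf : ∀ x ∈ B, ∀ t ∈ Icc (0 : ℝ) 1, H x t ≠ x) (h0 : ∀ x ∈ C, H x 0 = x₀) :
    ∃ x ∈ C, H x 1 = x := by
  refine exists_fixedPoint_of_homotopy_of_essential hBC hBcl hH hHK hcomp hfpf ?_
  intro T hT hTK hTcomp hTB
  exact exists_fixedPoint_of_eqOn_const hKconv hKcl hCK hC hB hx₀ hT hTK hTcomp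
    fun x hx => (hTB x hx).trans (h0 x (hBC hx))

/-- **The Leray–Schauder principle for compact maps** (Precup, Thm. 5.3 in the compact case,
Remark 5.1).  Let `K` be closed convex, `C ⊆ K` closed («`Ū`»), `B ⊆ C` closed with
`C ∩ closure (K \ C) ⊆ B` («`∂U`»), `x₀ ∈ C`, and let `T : C → K` be compact (continuous on `C`,
`T(C) ⊆ K` relatively compact).  If the LERAY–SCHAUDER BOUNDARY CONDITION holds,
`(1 − t)x₀ + t·T x ≠ x` for all `x ∈ B`, `t ∈ [0,1]`, then `T` has a fixed point in `C`.
[cite: Precup2002, Ch. 5, Thm. 5.3 (with Remark 5.1)] -/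
theorem exists_fixedPoint_leraySchauder {K C B : Set X} {T : X → X} {x₀ : X}
    (hKconv : Convex ℝ K) (hKcl : IsClosed K) (hCK : C ⊆ K) (hC : IsClosed C) (hBC : B ⊆ C)
    (hBcl : IsClosed B) (hB : C ∩ closure (K \ C) ⊆ B) (hx₀ : x₀ ∈ C)
    (hT : ContinuousOn T C) (hTK : MapsTo T C K) (hcomp : IsCompact (closure (T '' C)))
    (hbdry : ∀ x ∈ B, ∀ t ∈ Icc (0 : ℝ) 1, (1 - t) • x₀ + t • T x ≠ x) :
    ∃ x ∈ C, T x = x := by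
  set H : X → ℝ → X := fun x t => (1 - t) • x₀ + t • T x with hHdef
  have hH : ContinuousOn (fun p : X × ℝ => H p.1 p.2) (C ×ˢ Icc (0 : ℝ) 1) := by
    have h2 : ContinuousOn (fun p : X × ℝ => T p.1) (C ×ˢ Icc (0 : ℝ) 1) :=
      hT.comp continuous_fst.continuousOn fun p hp => hp.1
    exact ((continuousOn_const.sub continuous_snd.continuousOn).smul continuousOn_const).add
      (continuous_snd.continuousOn.smul h2)
  have hHK : ∀ x ∈ C, ∀ t ∈ Icc (0 : ℝ) 1, H x t ∈ K := fun x hx t ht =>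
    hKconv (hCK hx₀) (hTK hx) (by linarith [ht.2]) ht.1 (by ring)
  have hHcomp : IsCompact (closure ((fun p : X × ℝ => H p.1 p.2) '' (C ×ˢ Icc (0 : ℝ) 1))) := by
    have hM : IsCompact ((fun w : ℝ × X => (1 - w.1) • x₀ + w.1 • w.2) ''
        (Icc (0 : ℝ) 1 ×ˢ closure (T '' C))) := by
      refine (isCompact_Icc.prod hcomp).image ?_
      exact ((continuous_const.sub continuous_fst).smul continuous_const).add
        (continuous_fst.smul continuous_snd)
    refine hM.closure_of_subset ?_
    rintro _ ⟨p, hp, rfl⟩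
    exact ⟨(p.2, T p.1), ⟨hp.2, subset_closure (mem_image_of_mem T hp.1)⟩, rfl⟩
  have h0 : ∀ x ∈ C, H x 0 = x₀ := fun x _ => by
    simp only [hHdef, sub_zero, one_smul, zero_smul, add_zero]
  obtain ⟨y, hyC, hy⟩ := exists_fixedPoint_of_homotopy_const hKconv hKcl hCK hC hBC hBcl hB hx₀
    hH hHK hHcomp hbdry h0
  refine ⟨y, hyC, ?_⟩
  simpa only [hHdef, sub_self, zero_smul, one_smul, zero_add] using hy

/-! ### The Leray–Schauder boundary condition makes a compact map essential -/

/-- **A compact map satisfying the Leray–Schauder boundary condition is ESSENTIAL** (Precup,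
Thm. 5.4 applied to the segment homotopy `(1−t)x₀ + tT` of Thm. 5.3, which starts at the essential
constant map `x₀` of Prop. 5.5 and is compact, `K`-valued and fixed-point free on `B`).  So `T` not
only has a fixed point (`exists_fixedPoint_leraySchauder`): every compact `T₁ : C → K` agreeing with
`T` on `B` has one, i.e. `T` can serve as the START of a further continuation
(`essential_of_homotopy`). [cite: Precup2002, Ch. 5, Thm. 5.3, Thm. 5.4, Prop. 5.5] -/
theorem essential_of_leraySchauder_boundary {K C B : Set X} {T : X → X} {x₀ : X}
    (hKconv : Convex ℝ K) (hKcl : IsClosed K) (hCK : C ⊆ K) (hC : IsClosed C) (hBC : B ⊆ C)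
    (hBcl : IsClosed B) (hB : C ∩ closure (K \ C) ⊆ B) (hx₀ : x₀ ∈ C)
    (hT : ContinuousOn T C) (hTK : MapsTo T C K) (hcomp : IsCompact (closure (T '' C)))
    (hbdry : ∀ x ∈ B, ∀ t ∈ Icc (0 : ℝ) 1, (1 - t) • x₀ + t • T x ≠ x) :
    ∀ T₁ : X → X, ContinuousOn T₁ C → MapsTo T₁ C K → IsCompact (closure (T₁ '' C)) →
      (∀ x ∈ B, T₁ x = T x) → ∃ x ∈ C, T₁ x = x := by
  set H : X → ℝ → X := fun x t => (1 - t) • x₀ + t • T x with hHdef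
  have hH : ContinuousOn (fun p : X × ℝ => H p.1 p.2) (C ×ˢ Icc (0 : ℝ) 1) := by
    have h2 : ContinuousOn (fun p : X × ℝ => T p.1) (C ×ˢ Icc (0 : ℝ) 1) :=
      hT.comp continuous_fst.continuousOn fun p hp => hp.1
    exact ((continuousOn_const.sub continuous_snd.continuousOn).smul continuousOn_const).add
      (continuous_snd.continuousOn.smul h2)
  have hHK : ∀ x ∈ C, ∀ t ∈ Icc (0 : ℝ) 1, H x t ∈ K := fun x hx t ht =>
    hKconv (hCK hx₀) (hTK hx) (by linarith [ht.2]) ht.1 (by ring)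
  have hHcomp : IsCompact (closure ((fun p : X × ℝ => H p.1 p.2) '' (C ×ˢ Icc (0 : ℝ) 1))) := by
    have hM : IsCompact ((fun w : ℝ × X => (1 - w.1) • x₀ + w.1 • w.2) ''
        (Icc (0 : ℝ) 1 ×ˢ closure (T '' C))) := by
      refine (isCompact_Icc.prod hcomp).image ?_
      exact ((continuous_const.sub continuous_fst).smul continuous_const).add
        (continuous_fst.smul continuous_snd)
    refine hM.closure_of_subset ?_
    rintro _ ⟨p, hp, rfl⟩
    exact ⟨(p.2, T p.1), ⟨hp.2, subset_closure (mem_image_of_mem T hp.1)⟩, rfl⟩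
  have h0 : ∀ x, H x 0 = x₀ := fun x => by
    simp only [hHdef, sub_zero, one_smul, zero_smul, add_zero]
  have h1 : ∀ x, H x 1 = T x := fun x => by
    simp only [hHdef, sub_self, zero_smul, one_smul, zero_add]
  have hess : ∀ T' : X → X, ContinuousOn T' C → MapsTo T' C K → IsCompact (closure (T' '' C)) →
      (∀ x ∈ B, T' x = H x 0) → ∃ x ∈ C, T' x = x := by
    intro T' hT' hT'K hT'comp hT'B
    exact exists_fixedPoint_of_eqOn_const hKconv hKcl hCK hC hB hx₀ hT' hT'K hT'comp
      fun x hx => (hT'B x hx).trans (h0 x)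
  intro T₁ hT₁ hT₁K hT₁comp hT₁B
  exact essential_of_homotopy hKconv hBC hBcl hH hHK hHcomp hbdry hess T₁ hT₁ hT₁K hT₁comp
    fun x hx => (hT₁B x hx).trans (h1 x).symm

/-- **A compact map with an attracting centre off the boundary is essential**: if `p ∈ C`, `p ∉ B`
and `‖T x − p‖ ≤ q‖x − p‖` on `C` for some `q < 1` (e.g. `T` a contraction of `C` with fixed point
`p`), then the Leray–Schauder boundary condition with `x₀ = p` holds (a solution of
`x = (1−t)p + tT x` on `B` would satisfy `‖x − p‖ ≤ tq‖x − p‖`, so `x = p ∈ B`), hence `T` is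
essential — the usual way a contraction regime starts a continuation.
[cite: Precup2002, Ch. 5, Thm. 5.3, Thm. 5.4, Prop. 5.5] -/
theorem essential_of_contractive {K C B : Set X} {T : X → X} {p : X} {q : ℝ}
    (hKconv : Convex ℝ K) (hKcl : IsClosed K) (hCK : C ⊆ K) (hC : IsClosed C) (hBC : B ⊆ C)
    (hBcl : IsClosed B) (hB : C ∩ closure (K \ C) ⊆ B) (hp : p ∈ C) (hpB : p ∉ B) (hq : q < 1)
    (hT : ContinuousOn T C) (hTK : MapsTo T C K) (hcomp : IsCompact (closure (T '' C)))
    (hcontr : ∀ x ∈ C, ‖T x - p‖ ≤ q * ‖x - p‖) :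
    ∀ T₁ : X → X, ContinuousOn T₁ C → MapsTo T₁ C K → IsCompact (closure (T₁ '' C)) →
      (∀ x ∈ B, T₁ x = T x) → ∃ x ∈ C, T₁ x = x := by
  refine essential_of_leraySchauder_boundary hKconv hKcl hCK hC hBC hBcl hB hp hT hTK hcomp ?_
  intro x hx t ht heq
  have hxC : x ∈ C := hBC hx
  have hdiff : x - p = t • (T x - p) := by
    have : x - p = ((1 - t) • p + t • T x) - p := by rw [heq]
    rw [this, smul_sub, sub_smul, one_smul]
    abel
  have hnorm : ‖x - p‖ ≤ t * (q * ‖x - p‖) := by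
    calc ‖x - p‖ = t * ‖T x - p‖ := by rw [hdiff, norm_smul, Real.norm_of_nonneg ht.1]
      _ ≤ t * (q * ‖x - p‖) := mul_le_mul_of_nonneg_left (hcontr x hxC) ht.1
  have hzero : ‖x - p‖ = 0 := by
    by_contra hne
    have hpos : 0 < ‖x - p‖ := lt_of_le_of_ne (norm_nonneg _) (Ne.symm hne)
    -- `1 ≤ t q`, impossible for `0 ≤ t ≤ 1`, `q < 1`
    have htq : 1 ≤ t * q := by
      by_contra hlt
      push Not at hlt
      have : t * q * ‖x - p‖ < 1 * ‖x - p‖ := mul_lt_mul_of_pos_right hlt hpos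
      linarith
    rcases le_or_gt q 0 with hq0 | hq0
    · have : t * q ≤ 0 := mul_nonpos_of_nonneg_of_nonpos ht.1 hq0
      linarith
    · have : t * q ≤ 1 * q := mul_le_mul_of_nonneg_right ht.2 hq0.le
      linarith
  have hxp : x = p := by
    rw [norm_eq_zero, sub_eq_zero] at hzero
    exact hzero
  exact hpB (hxp ▸ hx)

/-! ### Reparametrised homotopies and the nonlinear alternative on balls -/

/-- **Topological transversality along a parameter interval `[a, b]`**: a compact homotopy
`H : C × [a,b] → K` (`K` convex, `B ⊆ C` closed), fixed-point free on `B`, whose start `H(·,a)` is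
essential, has an essential end `H(·,b)` (reparametrise `t ↦ a + t(b − a)` in `essential_of_homotopy`).
This is the form used for continuation in a physical parameter. [cite: Precup2002, Ch. 5, Thm. 5.4] -/
theorem essential_of_homotopy_interval {K C B : Set X} {H : X → ℝ → X} {a b : ℝ} (hab : a ≤ b)
    (hKconv : Convex ℝ K) (hBC : B ⊆ C) (hBcl : IsClosed B)
    (hH : ContinuousOn (fun p : X × ℝ => H p.1 p.2) (C ×ˢ Icc a b))
    (hHK : ∀ x ∈ C, ∀ t ∈ Icc a b, H x t ∈ K)
    (hcomp : IsCompact (closure ((fun p : X × ℝ => H p.1 p.2) '' (C ×ˢ Icc a b))))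
    (hfpf : ∀ x ∈ B, ∀ t ∈ Icc a b, H x t ≠ x)
    (hess : ∀ T : X → X, ContinuousOn T C → MapsTo T C K → IsCompact (closure (T '' C)) →
      (∀ x ∈ B, T x = H x a) → ∃ x ∈ C, T x = x) :
    ∀ T₁ : X → X, ContinuousOn T₁ C → MapsTo T₁ C K → IsCompact (closure (T₁ '' C)) →
      (∀ x ∈ B, T₁ x = H x b) → ∃ x ∈ C, T₁ x = x := by
  set θ : ℝ → ℝ := fun t => a + t * (b - a) with hθdef
  have hθcont : Continuous θ := continuous_const.add (continuous_id.mul continuous_const)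
  have hθmem : ∀ t ∈ Icc (0 : ℝ) 1, θ t ∈ Icc a b := by
    intro t ht
    refine ⟨?_, ?_⟩
    · show a ≤ a + t * (b - a); nlinarith [ht.1]
    · show a + t * (b - a) ≤ b; nlinarith [ht.2]
  have hθ0 : θ 0 = a := by simp [hθdef]
  have hθ1 : θ 1 = b := by simp [hθdef]
  set G : X → ℝ → X := fun x t => H x (θ t) with hGdef
  have hGcont : ContinuousOn (fun p : X × ℝ => G p.1 p.2) (C ×ˢ Icc (0 : ℝ) 1) := by
    have hg : ContinuousOn (fun p : X × ℝ => (p.1, θ p.2)) (C ×ˢ Icc (0 : ℝ) 1) :=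
      (continuous_fst.prodMk (hθcont.comp continuous_snd)).continuousOn
    exact hH.comp hg fun p hp => ⟨hp.1, hθmem _ hp.2⟩
  have hGK : ∀ x ∈ C, ∀ t ∈ Icc (0 : ℝ) 1, G x t ∈ K := fun x hx t ht => hHK x hx _ (hθmem t ht)
  have hGcomp : IsCompact (closure ((fun p : X × ℝ => G p.1 p.2) '' (C ×ˢ Icc (0 : ℝ) 1))) := by
    refine hcomp.closure_of_subset ?_
    rintro _ ⟨p, hp, rfl⟩
    exact subset_closure ⟨(p.1, θ p.2), ⟨hp.1, hθmem _ hp.2⟩, rfl⟩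
  have hGfpf : ∀ x ∈ B, ∀ t ∈ Icc (0 : ℝ) 1, G x t ≠ x := fun x hx t ht => hfpf x hx _ (hθmem t ht)
  have hGess : ∀ T : X → X, ContinuousOn T C → MapsTo T C K → IsCompact (closure (T '' C)) →
      (∀ x ∈ B, T x = G x 0) → ∃ x ∈ C, T x = x := by
    intro T hT hTK hTc hTB
    exact hess T hT hTK hTc fun x hx => by rw [hTB x hx]; simp only [hGdef, hθ0]
  intro T₁ hT₁ hT₁K hT₁comp hT₁B
  exact essential_of_homotopy hKconv hBC hBcl hGcont hGK hGcomp hGfpf hGess T₁ hT₁ hT₁K hT₁comp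
    fun x hx => by rw [hT₁B x hx]; simp only [hGdef, hθ1]

/-- **The Leray–Schauder (nonlinear) alternative on a ball of a closed convex set** (Precup,
Thm. 5.3 with `U = K ∩ B(x₀, r)`, compact case): let `K` be closed convex, `x₀ ∈ K`, `r > 0`, and
`T : K ∩ B̄(x₀,r) → K` compact.  Then EITHER `T` has a fixed point in `K ∩ B̄(x₀,r)`, OR there are
`x ∈ K` with `‖x − x₀‖ = r` and `t ∈ (0,1)` with `x = (1 − t)x₀ + t·T x` (an «eigen-solution» on
the sphere).  Hence an a-priori bound excluding the second alternative gives existence.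
[cite: Precup2002, Ch. 5, Thm. 5.3] -/
theorem leraySchauder_alternative_ball {K : Set X} {T : X → X} {x₀ : X} {r : ℝ}
    (hKconv : Convex ℝ K) (hKcl : IsClosed K) (hx₀ : x₀ ∈ K) (hr : 0 < r)
    (hT : ContinuousOn T (K ∩ closedBall x₀ r)) (hTK : MapsTo T (K ∩ closedBall x₀ r) K)
    (hcomp : IsCompact (closure (T '' (K ∩ closedBall x₀ r)))) :
    (∃ x ∈ K ∩ closedBall x₀ r, T x = x) ∨
      ∃ x ∈ K, ‖x - x₀‖ = r ∧ ∃ t ∈ Ioo (0 : ℝ) 1, (1 - t) • x₀ + t • T x = x := by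
  by_contra hcon
  rw [not_or] at hcon
  obtain ⟨h1, h2⟩ := hcon
  push Not at h1 h2
  have hrel : (K ∩ closedBall x₀ r) ∩ closure (K \ (K ∩ closedBall x₀ r)) ⊆ K ∩ sphere x₀ r := by
    rintro x ⟨⟨hxK, hxball⟩, hxcl⟩
    refine ⟨hxK, ?_⟩
    have hge : r ≤ dist x x₀ := by
      have hsub : K \ (K ∩ closedBall x₀ r) ⊆ {y | r ≤ dist y x₀} := by
        rintro y ⟨hyK, hy⟩
        have : y ∉ closedBall x₀ r := fun h => hy ⟨hyK, h⟩
        exact (not_le.1 fun h => this (mem_closedBall.2 h)).le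
      have hcl : IsClosed {y : X | r ≤ dist y x₀} :=
        isClosed_le continuous_const (continuous_id.dist continuous_const)
      exact closure_minimal hsub hcl hxcl
    exact mem_sphere.2 (le_antisymm (mem_closedBall.1 hxball) hge)
  have hbdry : ∀ x ∈ K ∩ sphere x₀ r, ∀ t ∈ Icc (0 : ℝ) 1, (1 - t) • x₀ + t • T x ≠ x := by
    rintro x ⟨hxK, hxs⟩ t ht heq
    have hxr : ‖x - x₀‖ = r := mem_sphere_iff_norm.1 hxs
    rcases eq_or_lt_of_le ht.1 with ht0 | ht0
    · subst ht0
      simp only [sub_zero, one_smul, zero_smul, add_zero] at heq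
      rw [← heq, sub_self, norm_zero] at hxr
      exact hr.ne hxr
    · rcases eq_or_lt_of_le ht.2 with ht1 | ht1
      · subst ht1
        simp only [sub_self, zero_smul, one_smul, zero_add] at heq
        exact h1 x ⟨hxK, sphere_subset_closedBall hxs⟩ heq
      · exact h2 x hxK hxr t ⟨ht0, ht1⟩ heq
  obtain ⟨y, hyC, hy⟩ := exists_fixedPoint_leraySchauder (B := K ∩ sphere x₀ r) hKconv hKcl
    inter_subset_left (hKcl.inter isClosed_closedBall)
    (inter_subset_inter_right K sphere_subset_closedBall) (hKcl.inter isClosed_sphere) hrel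
    ⟨hx₀, mem_closedBall_self hr.le⟩ hT hTK hcomp hbdry
  exact h1 y hyC hy

/-! ### Packaged forms: compact domains, contractive start -/

omit [NormedSpace ℝ X] in
/-- On a COMPACT domain `C` every map / homotopy continuous on `C` (resp. `C × [a,b]`) has relatively
compact range — the compactness clause of the class `M_C` is automatic (e.g. boxes of truncated lattice
states in `ℝⁿ`). [folklore] -/
private theorem isCompact_closure_image_of_isCompact {C : Set X} {a b : ℝ} {H : X → ℝ → X}
    (hC : IsCompact C) (hH : ContinuousOn (fun p : X × ℝ => H p.1 p.2) (C ×ˢ Icc a b)) :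
    IsCompact (closure ((fun p : X × ℝ => H p.1 p.2) '' (C ×ˢ Icc a b))) :=
  ((hC.prod isCompact_Icc).image_of_continuousOn hH).closure_of_subset Subset.rfl

/-- **Continuation from a constant over a parameter interval on a compact domain**: `K` closed convex,
`C ⊆ K` compact, `B ⊆ C` closed with `C ∩ closure (K \ C) ⊆ B`, `H` continuous on `C × [a,b]` with
values in `K`, fixed-point free on `B`, `H(·,a) ≡ x₀ ∈ C`; then `H(·,b)` has a fixed point in `C`.
(Brouwer-type continuation in `ℝⁿ` is the case `X = ℝⁿ`.) [cite: Precup2002, Ch. 5, Thm. 5.4, Prop. 5.5] -/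
theorem exists_fixedPoint_of_homotopy_const_of_isCompact {K C B : Set X} {H : X → ℝ → X} {x₀ : X}
    {a b : ℝ} (hab : a ≤ b) (hKconv : Convex ℝ K) (hKcl : IsClosed K) (hCK : C ⊆ K)
    (hC : IsCompact C) (hBC : B ⊆ C) (hBcl : IsClosed B) (hB : C ∩ closure (K \ C) ⊆ B) (hx₀ : x₀ ∈ C)
    (hH : ContinuousOn (fun p : X × ℝ => H p.1 p.2) (C ×ˢ Icc a b))
    (hHK : ∀ x ∈ C, ∀ t ∈ Icc a b, H x t ∈ K) (hfpf : ∀ x ∈ B, ∀ t ∈ Icc a b, H x t ≠ x)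
    (h0 : ∀ x ∈ C, H x a = x₀) : ∃ x ∈ C, H x b = x := by
  have hcomp := isCompact_closure_image_of_isCompact hC hH
  have hess : ∀ T : X → X, ContinuousOn T C → MapsTo T C K → IsCompact (closure (T '' C)) →
      (∀ x ∈ B, T x = H x a) → ∃ x ∈ C, T x = x := by
    intro T hT hTK hTcomp hTB
    exact exists_fixedPoint_of_eqOn_const hKconv hKcl hCK hC.isClosed hB hx₀ hT hTK hTcomp
      fun x hx => (hTB x hx).trans (h0 x (hBC hx))
  have hb : ContinuousOn (fun x => H x b) C := by
    have hg : ContinuousOn (fun x : X => (x, b)) C := (continuous_id.prodMk continuous_const).continuousOn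
    exact hH.comp hg fun x hx => ⟨hx, right_mem_Icc.2 hab⟩
  have hbK : MapsTo (fun x => H x b) C K := fun x hx => hHK x hx b (right_mem_Icc.2 hab)
  have hbcomp : IsCompact (closure ((fun x => H x b) '' C)) := by
    refine hcomp.closure_of_subset ?_
    rintro _ ⟨x, hx, rfl⟩
    exact subset_closure ⟨(x, b), ⟨hx, right_mem_Icc.2 hab⟩, rfl⟩
  exact essential_of_homotopy_interval hab hKconv hBC hBcl hH hHK hcomp hfpf hess _ hb hbK hbcomp
    fun _ _ => rfl

/-- **Continuation from a contractive start over a parameter interval**: `K` closed convex, `C ⊆ K`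
closed, `B ⊆ C` closed with `C ∩ closure (K \ C) ⊆ B`; `H` a compact homotopy on `C × [a,b]` with values
in `K`, fixed-point free on `B`; the start `H(·,a)` has an attracting centre `p ∈ C \ B`
(`‖H(x,a) − p‖ ≤ q‖x − p‖`, `q < 1`).  Then the end `H(·,b)` has a fixed point in `C` (indeed it is
essential: `essential_of_contractive` + `essential_of_homotopy_interval`).  This is the shape
«contraction regime at one end of the parameter range + a-priori bounds along the range ⇒ existence at
the other end». [cite: Precup2002, Ch. 5, Thm. 5.3, Thm. 5.4, Prop. 5.5] -/
theorem exists_fixedPoint_of_homotopy_contractive {K C B : Set X} {H : X → ℝ → X} {p : X} {q a b : ℝ}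
    (hab : a ≤ b) (hKconv : Convex ℝ K) (hKcl : IsClosed K) (hCK : C ⊆ K) (hC : IsClosed C)
    (hBC : B ⊆ C) (hBcl : IsClosed B) (hB : C ∩ closure (K \ C) ⊆ B) (hp : p ∈ C) (hpB : p ∉ B)
    (hq : q < 1) (hH : ContinuousOn (fun p : X × ℝ => H p.1 p.2) (C ×ˢ Icc a b))
    (hHK : ∀ x ∈ C, ∀ t ∈ Icc a b, H x t ∈ K)
    (hcomp : IsCompact (closure ((fun p : X × ℝ => H p.1 p.2) '' (C ×ˢ Icc a b))))
    (hfpf : ∀ x ∈ B, ∀ t ∈ Icc a b, H x t ≠ x)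
    (hcontr : ∀ x ∈ C, ‖H x a - p‖ ≤ q * ‖x - p‖) : ∃ x ∈ C, H x b = x := by
  -- the end maps `H(·,a)`, `H(·,b)` are compact maps `C → K`
  have hend : ∀ c ∈ Icc a b, ContinuousOn (fun x => H x c) C ∧ MapsTo (fun x => H x c) C K ∧
      IsCompact (closure ((fun x => H x c) '' C)) := by
    intro c hc
    refine ⟨?_, fun x hx => hHK x hx c hc, ?_⟩
    · have hg : ContinuousOn (fun x : X => (x, c)) C :=
        (continuous_id.prodMk continuous_const).continuousOn
      exact hH.comp hg fun x hx => ⟨hx, hc⟩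
    · refine hcomp.closure_of_subset ?_
      rintro _ ⟨x, hx, rfl⟩
      exact subset_closure ⟨(x, c), ⟨hx, hc⟩, rfl⟩
  obtain ⟨ha1, ha2, ha3⟩ := hend a (left_mem_Icc.2 hab)
  obtain ⟨hb1, hb2, hb3⟩ := hend b (right_mem_Icc.2 hab)
  have hess := essential_of_contractive hKconv hKcl hCK hC hBC hBcl hB hp hpB hq ha1 ha2 ha3 hcontr
  exact essential_of_homotopy_interval hab hKconv hBC hBcl hH hHK hcomp hfpf
    (fun T hT hTK hTc hTB => hess T hT hTK hTc hTB) _ hb1 hb2 hb3 fun _ _ => rfl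

/-! ### The classical form: an open set of the whole space -/

/-- **The Leray–Schauder principle, classical form** (Precup, Thm. 5.3 with `K = X`): `U ⊆ X` open,
`x₀ ∈ U`, `T : Ū → X` compact (continuous on `closure U`, relatively compact range), and
`(1 − t)x₀ + t·T x ≠ x` for `x ∈ ∂U`, `t ∈ [0,1]` ⟹ `T` has a fixed point in `closure U`.  (Here
`C = closure U`, `B = frontier U`; a point of `Ū` adherent to `X \ Ū` is not in the open set `U`, hence
lies on `∂U`.) [cite: Precup2002, Ch. 5, Thm. 5.3] -/
theorem exists_fixedPoint_leraySchauder_isOpen {U : Set X} {T : X → X} {x₀ : X} (hU : IsOpen U)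
    (hx₀ : x₀ ∈ U) (hT : ContinuousOn T (closure U))
    (hcomp : IsCompact (closure (T '' closure U)))
    (hbdry : ∀ x ∈ frontier U, ∀ t ∈ Icc (0 : ℝ) 1, (1 - t) • x₀ + t • T x ≠ x) :
    ∃ x ∈ closure U, T x = x := by
  have hB : closure U ∩ closure (univ \ closure U) ⊆ frontier U := by
    rintro x ⟨hxcl, hxc⟩
    rw [hU.frontier_eq]
    refine ⟨hxcl, fun hxU => ?_⟩
    rw [← compl_eq_univ_sdiff, closure_compl] at hxc
    exact hxc (interior_maximal subset_closure hU hxU)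
  exact exists_fixedPoint_leraySchauder (K := univ) convex_univ isClosed_univ (subset_univ _)
    isClosed_closure frontier_subset_closure isClosed_frontier hB (subset_closure hx₀) hT
    (mapsTo_univ T _) hcomp hbdry

end TopologicalTransversality

end Literature.Analysis.Convex

end
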